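import Mathlib

/-!
# `MatrixDescartes` census — rank-one `(2,3)₁`: the critical directions of a THREE-letter window profile are WEIGHT-FREE
# (Cramer elimination of the point weights; one explicit polynomial equation in the direction, all weights at once)

HONEST FRAMING.  Object-search cell `pub-symmetroid`, seat `val-sym-mdr-p1` (generation 21); helper file `--supports` the crux item
stmt-ValiantsHypothesis-18050 (`Theses.LacunarySymmetroid.MatrixDescartes`, OPEN, on HOLD) with NO closure claim.  Companion of
`…PivotRankOneCriticalWindows` (the CRITICAL WINDOWS LAW): the base case `K = 3` of the lineage's «per-side» programme (pivot letter `0` at `t₀`,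
rate `−a = d₀ − e < 0`; upper letters `i`, `j` at `tᵢ`, `tⱼ`, rates `bᵢ = dᵢ − e`, `bⱼ = dⱼ − e > 0`; point weights `Wₖ = wₖx^{dₖ}`; direction `T`).
The `(2,3)₁` COUNT is already in the kernel (`…PivotRankOneThree`: `Z₊ ≤ 5` by Descartes with parity, sharp); this file proves no count — it records the
MECHANISM by which the weights drop out of the critical-point problem, which is what makes the three-letter case one-dimensional (and the four-letter
case two-dimensional).  Nothing here bears on `MatrixDescartes` in its window, on `DoorA26` / `DoorA34`, registers / credences, or `VP ≠ VNP`.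

THE POINT.  The two critical equations of the window profile `𝔅(x,T) = ∑ₖ wₖx^{dₖ}(T − tₖ)²/(T x^e)` (`∂_T`: `∑ Wₖ(T² − tₖ²) = 0`; `x∂ₓ`:
`∑(dₖ − e)Wₖ(T − tₖ)² = 0`) are LINEAR in the point-weight vector `(W₀, Wᵢ, Wⱼ)`.  For three letters the weight vector is therefore proportional to the
cross product `X(T) = A(T) × B(T)` of the two coefficient vectors (`Aₖ = T² − tₖ²`, `Bₖ = (dₖ−e)(T−tₖ)²`):
* `weights_prop_cross` (§1) — `Wᵢ·X₀(T) = W₀·Xᵢ(T)` and `Wⱼ·X₀(T) = W₀·Xⱼ(T)` with the explicit cubics/quartics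
  `X₀ = (T−tᵢ)(T−tⱼ)[bⱼ(T+tᵢ)(T−tⱼ) − bᵢ(T+tⱼ)(T−tᵢ)]`, `Xᵢ = (T−tⱼ)(T−t₀)[bⱼ(T+t₀)(tⱼ−T) − a(T+tⱼ)(T−t₀)]`,
  `Xⱼ = (T−t₀)(T−tᵢ)[bᵢ(T+t₀)(T−tᵢ) + a(T+tᵢ)(T−t₀)]`.
* `cross_signs` (§2) — on the lone letter's side (`tᵢ < t₀ < T < tⱼ`): `X₀ > 0`, `Xⱼ > 0`, and `Xᵢ > 0 ⟺ bⱼ(T+t₀)(tⱼ−T) < a(T−t₀)(tⱼ+T)` (the WINDOW of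
  letter `j`, as in the critical windows law — re-derived here from `Wᵢ X₀ = W₀ Xᵢ > 0`: `window_of_critical_three`).
* **`weightFree_critical_equation` (§3)** — eliminating `x` from `Wₖ = wₖx^{dₖ}` (`dᵢ = d₀ + q`, `dⱼ = d₀ + p`):
  `wⱼ^q w₀^p · Xᵢ(T)^p X₀(T)^q = wᵢ^p w₀^q · Xⱼ(T)^q X₀(T)^p`.  So the critical directions of a three-letter configuration are the solutions of ONE
  explicit polynomial equation `Λ(T) := Xᵢ^p X₀^{q−p} / Xⱼ^q = wᵢ^p w₀^{q−p}/wⱼ^q` whose left side does not see the weights: the weights only choose the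
  LEVEL.  READING (seat memo PROFILE-GAUGE.md §4, located): on the window `(mⱼ, tⱼ)` the function `log Λ` has exactly ONE critical point in 2 000/2 000
  random configurations, so every level is taken at most twice — at most two critical directions on the lone letter's side FOR ALL WEIGHTS AT ONCE, i.e. at
  most one local maximum of the ψ-profile there («lone-letter law», the `K = 3` instance of the located per-side law; the analytic unimodality of `Λ` is NOT
  proved here).
[folklore] Cramer's rule for a `2 × 3` homogeneous system; elementary sign bookkeeping; `ring`.  No definitions, no named facts.
-/

-- `Summit.ValiantsHypothesis.ValiantsHypothesis.…` repeats a component by the D-0017 layout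
-- (single-conjunct summit), which the `dupNamespace` linter flags; the name is mandated.
set_option linter.dupNamespace false

namespace Summit.ValiantsHypothesis.ValiantsHypothesis.Theorems.LacunarySymmetroidMatrixDescartes.Pivot.CriticalWindows.Three

/-! ## 1. Cramer: the point weights are proportional to the cross product of the two critical covectors -/

/-- **WEIGHTS ∝ CROSS PRODUCT.**  If `W₀A₀ + WᵢAᵢ + WⱼAⱼ = 0` and `W₀B₀ + WᵢBᵢ + WⱼBⱼ = 0` then `Wᵢ·(AᵢBⱼ − AⱼBᵢ) = W₀·(AⱼB₀ − A₀Bⱼ)` and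
`Wⱼ·(AᵢBⱼ − AⱼBᵢ) = W₀·(A₀Bᵢ − AᵢB₀)` (the weight vector is orthogonal to `A` and `B`, hence parallel to `A × B`). [folklore] -/
theorem prop_cross_of_two_eqs (W₀ Wi Wj A₀ Ai Aj B₀ Bi Bj : ℝ)
    (h1 : W₀ * A₀ + Wi * Ai + Wj * Aj = 0) (h2 : W₀ * B₀ + Wi * Bi + Wj * Bj = 0) :
    Wi * (Ai * Bj - Aj * Bi) = W₀ * (Aj * B₀ - A₀ * Bj) ∧ Wj * (Ai * Bj - Aj * Bi) = W₀ * (A₀ * Bi - Ai * B₀) := by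
  constructor
  · linear_combination Bj * h1 - Aj * h2
  · linear_combination (-Bi) * h1 + Ai * h2

/-- **THE THREE-LETTER CROSS PRODUCT.**  With `Aₖ = T² − tₖ²` and `B₀ = −a(T−t₀)²`, `Bᵢ = bᵢ(T−tᵢ)²`, `Bⱼ = bⱼ(T−tⱼ)²` the cross product `A × B`
factors as `X₀ = (T−tᵢ)(T−tⱼ)[bⱼ(T+tᵢ)(T−tⱼ) − bᵢ(T+tⱼ)(T−tᵢ)]`, `Xᵢ = (T−tⱼ)(T−t₀)[bⱼ(T+t₀)(tⱼ−T) − a(T+tⱼ)(T−t₀)]`,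
`Xⱼ = (T−t₀)(T−tᵢ)[bᵢ(T+t₀)(T−tᵢ) + a(T+tᵢ)(T−t₀)]`. [folklore: computation] -/
theorem cross_factor (a bi bj t₀ ti tj T : ℝ) :
    ((T ^ 2 - ti ^ 2) * (bj * (T - tj) ^ 2) - (T ^ 2 - tj ^ 2) * (bi * (T - ti) ^ 2)
        = (T - ti) * (T - tj) * (bj * (T + ti) * (T - tj) - bi * (T + tj) * (T - ti))) ∧
      ((T ^ 2 - tj ^ 2) * (-a * (T - t₀) ^ 2) - (T ^ 2 - t₀ ^ 2) * (bj * (T - tj) ^ 2)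
        = (T - tj) * (T - t₀) * (bj * (T + t₀) * (tj - T) - a * (T + tj) * (T - t₀))) ∧
      ((T ^ 2 - t₀ ^ 2) * (bi * (T - ti) ^ 2) - (T ^ 2 - ti ^ 2) * (-a * (T - t₀) ^ 2)
        = (T - t₀) * (T - ti) * (bi * (T + t₀) * (T - ti) + a * (T + ti) * (T - t₀))) := by
  refine ⟨by ring, by ring, by ring⟩

/-- **WEIGHTS ∝ CROSS PRODUCT, three-letter window profile.**  At a critical point of the three-letter profile (pivot letter `0`, upper letters `i, j`;
`∂_T`-equation `W₀(T²−t₀²) + Wᵢ(T²−tᵢ²) + Wⱼ(T²−tⱼ²) = 0`, `x∂ₓ`-equation `−aW₀(T−t₀)² + bᵢWᵢ(T−tᵢ)² + bⱼWⱼ(T−tⱼ)² = 0`):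
`Wᵢ·X₀(T) = W₀·Xᵢ(T)` and `Wⱼ·X₀(T) = W₀·Xⱼ(T)` with the factored `X` of `cross_factor`. [folklore] -/
theorem weights_prop_cross (a bi bj t₀ ti tj T W₀ Wi Wj : ℝ)
    (h1 : W₀ * (T ^ 2 - t₀ ^ 2) + Wi * (T ^ 2 - ti ^ 2) + Wj * (T ^ 2 - tj ^ 2) = 0)
    (h2 : W₀ * (-a * (T - t₀) ^ 2) + Wi * (bi * (T - ti) ^ 2) + Wj * (bj * (T - tj) ^ 2) = 0) :
    Wi * ((T - ti) * (T - tj) * (bj * (T + ti) * (T - tj) - bi * (T + tj) * (T - ti)))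
        = W₀ * ((T - tj) * (T - t₀) * (bj * (T + t₀) * (tj - T) - a * (T + tj) * (T - t₀))) ∧
      Wj * ((T - ti) * (T - tj) * (bj * (T + ti) * (T - tj) - bi * (T + tj) * (T - ti)))
        = W₀ * ((T - t₀) * (T - ti) * (bi * (T + t₀) * (T - ti) + a * (T + ti) * (T - t₀))) := by
  obtain ⟨e₀, ei, ej⟩ := cross_factor a bi bj t₀ ti tj T
  obtain ⟨hi, hj⟩ := prop_cross_of_two_eqs W₀ Wi Wj (T ^ 2 - t₀ ^ 2) (T ^ 2 - ti ^ 2) (T ^ 2 - tj ^ 2)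
    (-a * (T - t₀) ^ 2) (bi * (T - ti) ^ 2) (bj * (T - tj) ^ 2) h1 h2
  rw [e₀, ei] at hi
  rw [e₀, ej] at hj
  exact ⟨hi, hj⟩

/-! ## 2. Signs on the lone letter's side, and the window once more -/

/-- **SIGNS OF THE CROSS PRODUCT on the lone letter's side.**  For `0 < tᵢ < t₀ < T < tⱼ` (letter `i` left of the pivot letter, letter `j` right of it,
direction between the pivot letter and `j`) and positive rates: `X₀(T) > 0` and `Xⱼ(T) > 0`. [folklore] -/
theorem cross_signs {a bi bj t₀ ti tj T : ℝ} (ha : 0 < a) (hbi : 0 < bi) (hbj : 0 < bj) (hti : 0 < ti) (hi0 : ti < t₀)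
    (h0T : t₀ < T) (hTj : T < tj) :
    0 < (T - ti) * (T - tj) * (bj * (T + ti) * (T - tj) - bi * (T + tj) * (T - ti)) ∧
      0 < (T - t₀) * (T - ti) * (bi * (T + t₀) * (T - ti) + a * (T + ti) * (T - t₀)) := by
  have h1 : 0 < T - ti := by linarith
  have h2 : T - tj < 0 := by linarith
  have h3 : 0 < T - t₀ := by linarith
  have h4 : 0 < T + ti := by linarith
  have h5 : 0 < T + tj := by linarith
  have h6 : 0 < T + t₀ := by linarith
  constructor
  · -- `(+)·(−)·(−)`
    have hb : bj * (T + ti) * (T - tj) - bi * (T + tj) * (T - ti) < 0 := by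
      have : bj * (T + ti) * (T - tj) < 0 := by
        have : 0 < bj * (T + ti) := mul_pos hbj h4
        nlinarith
      have : 0 < bi * (T + tj) * (T - ti) := mul_pos (mul_pos hbi h5) h1
      linarith
    have : 0 < (T - tj) * (bj * (T + ti) * (T - tj) - bi * (T + tj) * (T - ti)) := mul_pos_of_neg_of_neg h2 hb
    have h' : (T - ti) * (T - tj) * (bj * (T + ti) * (T - tj) - bi * (T + tj) * (T - ti))
        = (T - ti) * ((T - tj) * (bj * (T + ti) * (T - tj) - bi * (T + tj) * (T - ti))) := by ring
    rw [h']
    exact mul_pos h1 this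
  · have hb : 0 < bi * (T + t₀) * (T - ti) + a * (T + ti) * (T - t₀) := by
      have : 0 < bi * (T + t₀) * (T - ti) := mul_pos (mul_pos hbi h6) h1
      have : 0 < a * (T + ti) * (T - t₀) := mul_pos (mul_pos ha h4) h3
      linarith
    exact mul_pos (mul_pos h3 h1) hb

/-- **THE DIRECTION LIES BEYOND THE PIVOT LETTER ONLY IF `T < tⱼ`.**  From the `∂_T`-equation with positive weights and `tᵢ < t₀ < T`: `T < tⱼ`
(letter `j` is the only letter beyond the direction). [folklore] -/
theorem lt_of_critical_three {t₀ ti tj T W₀ Wi Wj : ℝ} (hW₀ : 0 < W₀) (hWi : 0 < Wi) (hWj : 0 < Wj) (hti : 0 < ti)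
    (htj : 0 < tj) (hi0 : ti < t₀) (h0T : t₀ < T)
    (h1 : W₀ * (T ^ 2 - t₀ ^ 2) + Wi * (T ^ 2 - ti ^ 2) + Wj * (T ^ 2 - tj ^ 2) = 0) : T < tj := by
  have hA : 0 < T ^ 2 - t₀ ^ 2 := by nlinarith
  have hB : 0 < T ^ 2 - ti ^ 2 := by nlinarith
  have hC : T ^ 2 - tj ^ 2 < 0 := by
    by_contra h
    push Not at h
    have := mul_pos hW₀ hA
    have := mul_pos hWi hB
    have := mul_nonneg hWj.le h
    linarith
  nlinarith

/-- **THE WINDOW, RE-DERIVED FROM THE CROSS PRODUCT.**  At a critical point of the three-letter profile with `0 < tᵢ < t₀ < T` and positive weights and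
rates: `T < tⱼ` and the STRICT window inequality `bⱼ(T+t₀)(tⱼ−T) < a(T−t₀)(tⱼ+T)` — because `Wᵢ·X₀ = W₀·Xᵢ` with `Wᵢ, W₀, X₀ > 0` forces `Xᵢ > 0`.
[folklore] -/
theorem window_of_critical_three {a bi bj t₀ ti tj T W₀ Wi Wj : ℝ} (ha : 0 < a) (hbi : 0 < bi) (hbj : 0 < bj)
    (hW₀ : 0 < W₀) (hWi : 0 < Wi) (hWj : 0 < Wj) (hti : 0 < ti) (htj : 0 < tj) (hi0 : ti < t₀) (h0T : t₀ < T)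
    (h1 : W₀ * (T ^ 2 - t₀ ^ 2) + Wi * (T ^ 2 - ti ^ 2) + Wj * (T ^ 2 - tj ^ 2) = 0)
    (h2 : W₀ * (-a * (T - t₀) ^ 2) + Wi * (bi * (T - ti) ^ 2) + Wj * (bj * (T - tj) ^ 2) = 0) :
    T < tj ∧ bj * (T + t₀) * (tj - T) < a * (T - t₀) * (tj + T) := by
  have hTj := lt_of_critical_three hW₀ hWi hWj hti htj hi0 h0T h1
  refine ⟨hTj, ?_⟩
  obtain ⟨hi, -⟩ := weights_prop_cross a bi bj t₀ ti tj T W₀ Wi Wj h1 h2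
  obtain ⟨hX₀, -⟩ := cross_signs ha hbi hbj hti hi0 h0T hTj
  -- `Wᵢ X₀ > 0`, hence `W₀ Xᵢ > 0`, hence `Xᵢ > 0`
  have hpos : 0 < W₀ * ((T - tj) * (T - t₀) * (bj * (T + t₀) * (tj - T) - a * (T + tj) * (T - t₀))) := by
    rw [← hi]; exact mul_pos hWi hX₀
  have hXi : 0 < (T - tj) * (T - t₀) * (bj * (T + t₀) * (tj - T) - a * (T + tj) * (T - t₀)) :=
    (mul_pos_iff_of_pos_left hW₀).mp hpos
  -- `(T − tⱼ)(T − t₀) < 0`, so the bracket is negative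
  have hneg : (T - tj) * (T - t₀) < 0 := mul_neg_of_neg_of_pos (by linarith) (by linarith)
  have hbr : bj * (T + t₀) * (tj - T) - a * (T + tj) * (T - t₀) < 0 := by
    by_contra h
    push Not at h
    have := mul_nonpos_of_nonpos_of_nonneg hneg.le h
    linarith
  linarith

/-! ## 3. Eliminating `x`: the weight-free critical equation -/

/-- **THE WEIGHT-FREE CRITICAL EQUATION.**  With point weights `Wₖ = wₖ x^{dₖ}` (`x ≠ 0`), `dᵢ = d₀ + q`, `dⱼ = d₀ + p`, the two proportionalities
`Wᵢ X₀ = W₀ Xᵢ`, `Wⱼ X₀ = W₀ Xⱼ` combine into ONE equation free of `x`: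
`wⱼ^q w₀^p · Xᵢ^p X₀^q = wᵢ^p w₀^q · Xⱼ^q X₀^p`.  So the weights only fix the LEVEL of the explicit function `Xᵢ^p X₀^{q−p}/Xⱼ^q` of the direction:
the critical directions of a three-letter configuration are a level set of one weight-free function. [folklore] -/
theorem weightFree_critical_equation (w₀ wi wj x X₀ Xi Xj : ℝ) (d₀ p q : ℕ) (hx : x ≠ 0)
    (hi : wi * x ^ (d₀ + q) * X₀ = w₀ * x ^ d₀ * Xi) (hj : wj * x ^ (d₀ + p) * X₀ = w₀ * x ^ d₀ * Xj) :
    wj ^ q * w₀ ^ p * (Xi ^ p * X₀ ^ q) = wi ^ p * w₀ ^ q * (Xj ^ q * X₀ ^ p) := by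
  have hi' : (wi * x ^ (d₀ + q) * X₀) ^ p = (w₀ * x ^ d₀ * Xi) ^ p := by rw [hi]
  have hj' : (wj * x ^ (d₀ + p) * X₀) ^ q = (w₀ * x ^ d₀ * Xj) ^ q := by rw [hj]
  -- multiply the target by `x^{p d₀ + q (d₀ + p)} = x^{q d₀ + p (d₀ + q)}`
  have key : wj ^ q * w₀ ^ p * (Xi ^ p * X₀ ^ q) * x ^ (p * d₀ + q * (d₀ + p))
      = wi ^ p * w₀ ^ q * (Xj ^ q * X₀ ^ p) * x ^ (q * d₀ + p * (d₀ + q)) := by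
    calc wj ^ q * w₀ ^ p * (Xi ^ p * X₀ ^ q) * x ^ (p * d₀ + q * (d₀ + p))
        = (w₀ * x ^ d₀ * Xi) ^ p * (wj * x ^ (d₀ + p) * X₀) ^ q := by ring
      _ = (wi * x ^ (d₀ + q) * X₀) ^ p * (w₀ * x ^ d₀ * Xj) ^ q := by rw [← hi', hj']
      _ = wi ^ p * w₀ ^ q * (Xj ^ q * X₀ ^ p) * x ^ (q * d₀ + p * (d₀ + q)) := by ring
  have hexp : p * d₀ + q * (d₀ + p) = q * d₀ + p * (d₀ + q) := by ring
  rw [hexp] at key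
  exact mul_right_cancel₀ (pow_ne_zero _ hx) key

/-- **… in the window profile's own terms.**  At a critical point of the three-letter profile (`Wₖ = wₖx^{dₖ}`, `x ≠ 0`, `dᵢ = d₀ + q`, `dⱼ = d₀ + p`):
`wⱼ^q w₀^p · Xᵢ(T)^p X₀(T)^q = wᵢ^p w₀^q · Xⱼ(T)^q X₀(T)^p` with the explicit `X` of `cross_factor` — ALL weights on one side, ALL geometry
(`T`, `tₖ`, rates) on the other. [folklore] -/
theorem weightFree_critical_equation_three (a bi bj t₀ ti tj T w₀ wi wj x : ℝ) (d₀ p q : ℕ) (hx : x ≠ 0)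
    (h1 : w₀ * x ^ d₀ * (T ^ 2 - t₀ ^ 2) + wi * x ^ (d₀ + q) * (T ^ 2 - ti ^ 2) + wj * x ^ (d₀ + p) * (T ^ 2 - tj ^ 2) = 0)
    (h2 : w₀ * x ^ d₀ * (-a * (T - t₀) ^ 2) + wi * x ^ (d₀ + q) * (bi * (T - ti) ^ 2)
        + wj * x ^ (d₀ + p) * (bj * (T - tj) ^ 2) = 0) :
    wj ^ q * w₀ ^ p * (((T - tj) * (T - t₀) * (bj * (T + t₀) * (tj - T) - a * (T + tj) * (T - t₀))) ^ p
        * ((T - ti) * (T - tj) * (bj * (T + ti) * (T - tj) - bi * (T + tj) * (T - ti))) ^ q)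
      = wi ^ p * w₀ ^ q * (((T - t₀) * (T - ti) * (bi * (T + t₀) * (T - ti) + a * (T + ti) * (T - t₀))) ^ q
        * ((T - ti) * (T - tj) * (bj * (T + ti) * (T - tj) - bi * (T + tj) * (T - ti))) ^ p) := by
  obtain ⟨hi, hj⟩ := weights_prop_cross a bi bj t₀ ti tj T (w₀ * x ^ d₀) (wi * x ^ (d₀ + q)) (wj * x ^ (d₀ + p)) h1 h2
  exact weightFree_critical_equation w₀ wi wj x _ _ _ d₀ p q hx hi hj

end Summit.ValiantsHypothesis.ValiantsHypothesis.Theorems.LacunarySymmetroidMatrixDescartes.Pivot.CriticalWindows.Three
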